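import Literature.MathematicalPhysics.QuantumFieldTheory.Balaban1983to89.B4Thm19ZeroBoxHolderDualRateUnif
import Literature.MathematicalPhysics.QuantumFieldTheory.Balaban1983to89.B4Thm110ZeroBoxMeshOne

/-!
# `Balaban1983to89.B4Thm19ZeroBoxHolderDualMeshOne` — Lemma 2.2 (2.17) for `G_k(□)D^{η*}_μ` and the COLUMN
# COMPANION of Theorem (1.9) at `A = 0` on boxes: THE MESH-ONE MEMBERS `k = 0` (`η = 1`, `G₀(□) = (−Δ^N_□ + m² + a)⁻¹`)
# and the ALL-SCALES forms (`k ≥ 0`) of `lemma22_zero_box_Gdstar_roww_coeff`, `thm19Dual_zero_box_roww_coeff(_unif)`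
# — the binder «1 ≤ k» removed

statement-level skeleton of published theorems with citation tags; proofs where landed; nothing here is a claim about the Yang–Mills mass gap

**Source.** T. Bałaban, *Regularity and Decay of Lattice Green's Functions*, Commun. Math. Phys. **89**, 571–597 (1983)
(`Balaban1983RegularityDecay`, «B4»): p. 572 [PDF 2] (1.3)–(1.6), p. 573 [PDF 3] the Theorem (1.9)–(1.10), pp. 577–578
[PDF 7–8] Lemma 2.2 (2.16)–(2.17), p. 582 [PDF 12] Lemma 2.4 (2.35)–(2.36) «for arbitrary non-negative integer j»,
p. 583 [PDF 13] (2.40)–(2.41) «For q = p = 1 we get it by duality argument» (the sentences are quoted in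
`B4Lemma22ZeroBoxDerivDual`, `B4Thm19ZeroBoxHolderDual`, `B4Thm110ZeroBoxMeshOne`); T. Bałaban, CMP **96** (1984)
223–250 (`Balaban1984PropagatorsII`, «B6») p. 229 [PDF 7] (level-0 cubes), p. 234 [PDF 12] Proposition 2.2 (2.67)
(entries 3′, 5).  A new leaf; no existing module is touched; nothing of B4 is asserted as a fact; every input is a
kernel-proved theorem of the `B4*` package, USED BY NAME.

## WHY THIS FILE (row G-F3′-L0 of the lit-balaban cell, packet S-B; sequel of `B4Thm110ZeroBoxMeshOne`)

The two-level cube lane of [B6] Prop. 2.2 consumes, with the binder `∀ k, 1 ≤ k →` (B4 p. 572 «k is an arbitrary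
positive integer»): `B4Lemma22ZeroBoxDerivDual.lemma22_zero_box_Gdstar_roww_coeff` (entry 3′, `G D^{η*}`; consumer
`B6Ineq243AdjTwoLevelBox`), `B4Thm19ZeroBoxHolderDual.thm19Dual_zero_box_roww_coeff` and its `∃δ₀∀α∃c₀` re-threading
`B4Thm19ZeroBoxHolderDualRateUnif.…_unif` (entry 5, the column companion of (1.9); consumers
`B6Ineq243HolderDualTwoLevelBox`, `B6Prop22DualHolderTwoLevelBoxRateUnif`).  At mesh one (`k = 0`: `η = 1`, `P₀ = 1`,
the massive Neumann resolvent `G₀(□)` of `B4Thm110ZeroBoxMeshOne`; the `j = 0` member of Lemma 2.4 and the level-0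
cube type of [B6] p. 229) all three are ELEMENTARY consequences of the entry decay `|G₀(p,q)| ≤ C₀e^{−r|p−q|_∞}`
(`B4Thm110ZeroBoxMeshOne.boxOpR_one_inv_decay`): a differenced column is the sum of two decaying entries
(`|x′ − x|_∞ ≤ |x′ − fwd_μx|_∞ + 1`, `B4Lemma22ZeroBoxDerivDual.supNorm_sub_le_sub_fwd`), and the Hölder weight
`|x − x′|_∞^{−α}` is `≤ 1` on distinct lattice points (`B4StripSumsHolder.one_le_supNorm`,
`B4Thm19ZeroBoxHolder.holderWeight_le`).

## WHAT THIS FILE CERTIFIES (kernel-checked, zero `sorry`, no hypotheses; window `a ∈ [a₋, a₊]`, `m² ∈ [0, m²₊]`)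

* §1 `lemma22_zero_box_Gdstar_wsum_meshOne` — (2.17) for `G₀(□)D^{1*}_μ` at mesh one, weighted COLUMN form:
  `Σ_x |G₀(x′, fwd_μx) − G₀(x′, x)|e^{δ₀|x′−x|_∞} ≤ c₀` for every `x′` and axis `μ` (`fwd` of `B4Lemma22ZeroBoxDerivDual`);
* §2 `thm19Dual_zero_box_wsum2_meshOne` — the column companion of (1.9) at mesh one for EVERY `0 ≤ α ≤ 1`, with an
  `α`-independent constant: `Σ_z |(1/|x′−x|)^α((G₀(x′,fwd_μz) − G₀(x′,z)) − (G₀(x,fwd_μz) − G₀(x,z)))|e^{δ₀min} ≤ c₀`;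
* §3 the ALL-SCALES forms `lemma22_zero_box_Gdstar_roww_coeff_all`, `thm19Dual_zero_box_roww_coeff_all`,
  `thm19Dual_zero_box_roww_coeff_unif_all`: the three lineage theorems with `∀ (k : ℕ), 1 ≤ k →` replaced by
  `∀ (k : ℕ)` (remaining binders unchanged);  §4 non-vacuity (`d + 1 = 4`, `L = 2`, `α = 1/2`; mesh-one binders).

## DICTIONARY / HONEST SCOPE

As in `B4Thm110ZeroBoxMeshOne` and in the three lineage files (their HONEST SCOPE applies verbatim to the `k ≥ 1`
members).  B4 prints (1.9)/(2.17) for «k … an arbitrary positive integer»; the `k = 0` members are the degenerate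
unit-lattice case (covered in print by Lemma 2.4 at `j = 0` and by the level-0 cubes of [B6] pp. 229–230, «the
necessary properties of G′(□) are described in Lemma 2.2 [3]»); no claim is made that B4 states them verbatim.  At
mesh one the Hölder quotient is no regularity statement, whence the `α`-independent constant.

**Value = kernel certificate (the unit-lattice members of (2.17)-dual and of the column companion of (1.9) at `A = 0`
on boxes, and the all-scales forms the [B6] level-0 cube lane consumes), NOT summit progress**; no Literature fact
is minted.
-/

namespace Literature.MathematicalPhysics.QuantumFieldTheory.Balaban1983to89.B4Thm19ZeroBoxHolderDualMeshOne

open Finset Matrix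
open Literature.MathematicalPhysics.QuantumFieldTheory.Balaban1983to89.B4ContourShift
open Literature.MathematicalPhysics.QuantumFieldTheory.Balaban1983to89.B4Reflection242
open Literature.MathematicalPhysics.QuantumFieldTheory.Balaban1983to89.B4Green242Bridge
open Literature.MathematicalPhysics.QuantumFieldTheory.Balaban1983to89.B4BoxCov237
open Literature.MathematicalPhysics.QuantumFieldTheory.Balaban1983to89.B4Thm110ZeroBox
open Literature.MathematicalPhysics.QuantumFieldTheory.Balaban1983to89.B4Thm110ZeroBoxDeriv
open Literature.MathematicalPhysics.QuantumFieldTheory.Balaban1983to89.B4Thm19ZeroBoxHolder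
  (wsum2 wsum2_mono_rate holderWeight_le)
open Literature.MathematicalPhysics.QuantumFieldTheory.Balaban1983to89.B4Lemma22ZeroBoxDerivDual
  (fwd supNorm_sub_le_sub_fwd lemma22_zero_box_Gdstar_roww_coeff)
open Literature.MathematicalPhysics.QuantumFieldTheory.Balaban1983to89.B4Thm19ZeroBoxHolderDual
  (thm19Dual_zero_box_roww_coeff)
open Literature.MathematicalPhysics.QuantumFieldTheory.Balaban1983to89.B4Thm19ZeroBoxHolderDualRateUnif
  (thm19Dual_zero_box_roww_coeff_unif)
open Literature.MathematicalPhysics.QuantumFieldTheory.Balaban1983to89.B4Thm110ZeroBoxMeshOne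
  (boxOpR_one_inv_decay)
open B4StripSumsHolder (one_le_supNorm)
open B4Sect5Proof (latticeConst latticeConst_nonneg)

noncomputable section

variable {d : ℕ}

/-! ## §1 Lemma 2.2 (2.17) for `G₀(□)D^{1*}_μ` at mesh one: weighted columns of `G₀(x′, fwd_μ x) − G₀(x′, x)` -/

/-- **(2.17) FOR `G_k(□)D^{η*}_μ` AT MESH ONE** (weighted-column form): there are `δ₀, c₀ > 0` depending on `d` and
the window only such that for every `(a, m²)` in the window, every box, every axis `μ` and every `x′`:
`Σ_x |1·(G₀(x′, fwd_μx) − G₀(x′, x))|e^{δ₀|x′ − x|_∞} ≤ c₀` (both entries decay, `boxOpR_one_inv_decay`, and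
`|x′ − x|_∞ ≤ |x′ − fwd_μx|_∞ + 1`, `supNorm_sub_le_sub_fwd`; then `wsum_le_of_decay`).
[cite: Balaban1983RegularityDecay, Lemma 2.2 (2.17) p.578 (`G_kD^{η*}_μ`), p.583 (2.40)–(2.41), at η = 1] -/
theorem lemma22_zero_box_Gdstar_wsum_meshOne (d : ℕ) (amin aplus m2plus : ℝ) (ha : 0 < amin) :
    ∃ δ₀ c₀ : ℝ, 0 < δ₀ ∧ 0 < c₀ ∧ ∀ (a m2 : ℝ), amin ≤ a → a ≤ aplus → 0 ≤ m2 → m2 ≤ m2plus →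
      ∀ (M : Fin (d + 1) → ℕ) (μ : Fin (d + 1)) (x' : ↥(boxDom (fun i => 1 * M i))),
        wsum δ₀ 1 x' (fun x => (((1 : ℕ)) : ℝ) *
          ((boxOpR 1 a m2 M)⁻¹ x' (fwd (fun i => 1 * M i) μ x) - (boxOpR 1 a m2 M)⁻¹ x' x)) ≤ c₀ := by
  obtain ⟨r, C₀, hr, hC, h⟩ := boxOpR_one_inv_decay d amin aplus m2plus ha
  have hK1 : 1 ≤ latticeConst (d + 1) (r / 2) := one_le_latticeConst d (half_pos hr)
  have hC' : 0 < C₀ * (Real.exp r + 1) := by positivity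
  refine ⟨r / 2, C₀ * (Real.exp r + 1) * latticeConst (d + 1) (r / 2), half_pos hr,
    mul_pos hC' (lt_of_lt_of_le one_pos hK1), ?_⟩
  intro a m2 h1 h2 h3 h4 M μ x'
  refine wsum_le_of_decay le_rfl x' hC'.le hr (half_pos hr).le le_rfl fun x => ?_
  have hf := h a m2 h1 h2 h3 h4 M x' (fwd (fun i => 1 * M i) μ x)
  have hx := h a m2 h1 h2 h3 h4 M x' x
  have hdist : supNorm (x'.1 - x.1) ≤ supNorm (x'.1 - (fwd (fun i => 1 * M i) μ x).1) + 1 :=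
    supNorm_sub_le_sub_fwd μ x' x
  have hexp : Real.exp (-(r * supNorm (x'.1 - (fwd (fun i => 1 * M i) μ x).1)))
      ≤ Real.exp r * Real.exp (-(r * supNorm (x'.1 - x.1))) := by
    rw [← Real.exp_add]
    exact Real.exp_le_exp.2 (by nlinarith)
  rw [Nat.cast_one, one_mul]
  calc |(boxOpR 1 a m2 M)⁻¹ x' (fwd (fun i => 1 * M i) μ x) - (boxOpR 1 a m2 M)⁻¹ x' x|
      ≤ |(boxOpR 1 a m2 M)⁻¹ x' (fwd (fun i => 1 * M i) μ x)| + |(boxOpR 1 a m2 M)⁻¹ x' x| := abs_sub _ _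
    _ ≤ C₀ * Real.exp (-(r * supNorm (x'.1 - (fwd (fun i => 1 * M i) μ x).1)))
          + C₀ * Real.exp (-(r * supNorm (x'.1 - x.1))) := add_le_add hf hx
    _ ≤ C₀ * (Real.exp r * Real.exp (-(r * supNorm (x'.1 - x.1))))
          + C₀ * Real.exp (-(r * supNorm (x'.1 - x.1))) :=
        add_le_add (mul_le_mul_of_nonneg_left hexp hC.le) le_rfl
    _ = C₀ * (Real.exp r + 1) * Real.exp (-(r * supNorm (x'.1 - x.1))) := by ring

/-! ## §2 The column companion of Theorem (1.9) at mesh one -/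

/-- **THE COLUMN COMPANION OF (1.9) AT MESH ONE** (entry 5 of [B6] (2.67); the duality argument of B4 p. 583): there
are `δ₀, c₀ > 0` depending on `d` and the window only such that for EVERY `0 ≤ α ≤ 1`, every `(a, m²)` in the
window, every box, axis `μ` and every `x ≠ x′`:
`Σ_z |(1/|x′ − x|_∞)^α·1·((G₀(x′, fwd_μz) − G₀(x′, z)) − (G₀(x, fwd_μz) − G₀(x, z)))|·e^{δ₀min(|x−z|_∞,|x′−z|_∞)} ≤ c₀`
(weight `≤ 1`; each differenced column is controlled by `lemma22_zero_box_Gdstar_wsum_meshOne` about its own row index).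
[cite: Balaban1983RegularityDecay, Theorem (1.9) p.573 with (2.17) p.578 and p.583 (2.40)–(2.41), at η = 1]
[cite: Balaban1984PropagatorsII, Proposition 2.2 (2.67) p.234 (entry 5), level-0 cubes p.229] -/
theorem thm19Dual_zero_box_wsum2_meshOne (d : ℕ) (amin aplus m2plus : ℝ) (ha : 0 < amin) :
    ∃ δ₀ c₀ : ℝ, 0 < δ₀ ∧ 0 < c₀ ∧ ∀ (α : ℝ), 0 ≤ α → α ≤ 1 → ∀ (a m2 : ℝ), amin ≤ a → a ≤ aplus → 0 ≤ m2 →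
      m2 ≤ m2plus → ∀ (M : Fin (d + 1) → ℕ) (μ : Fin (d + 1)) (x x' : ↥(boxDom (fun i => 1 * M i))),
        x'.1 ≠ x.1 →
          ∑ z, |((((1 : ℕ)) : ℝ) / supNorm (x'.1 - x.1)) ^ α * ((((1 : ℕ)) : ℝ) *
                (((boxOpR 1 a m2 M)⁻¹ x' (fwd (fun i => 1 * M i) μ z) - (boxOpR 1 a m2 M)⁻¹ x' z)
                  - ((boxOpR 1 a m2 M)⁻¹ x (fwd (fun i => 1 * M i) μ z) - (boxOpR 1 a m2 M)⁻¹ x z)))|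
              * Real.exp (δ₀ * min (supNorm (x.1 - z.1)) (supNorm (x'.1 - z.1)) / (((1 : ℕ)) : ℝ)) ≤ c₀ := by
  obtain ⟨δ₀, c, hδ, hc, h⟩ := lemma22_zero_box_Gdstar_wsum_meshOne d amin aplus m2plus ha
  refine ⟨δ₀, 2 * c, hδ, by positivity, ?_⟩
  intro α hα0 hα1 a m2 h1 h2 h3 h4 M μ x x' hne
  set G := (boxOpR 1 a m2 M)⁻¹ with hGdef
  have hB := h a m2 h1 h2 h3 h4 M μ x
  have hA := h a m2 h1 h2 h3 h4 M μ x'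
  rw [wsum] at hA hB
  have hσ1 : 1 ≤ supNorm (x'.1 - x.1) := one_le_supNorm (sub_ne_zero.2 hne)
  have hw0 : 0 ≤ ((((1 : ℕ)) : ℝ) / supNorm (x'.1 - x.1)) ^ α :=
    Real.rpow_nonneg (div_nonneg (by positivity) (supNorm_nonneg _)) α
  have hw1 : ((((1 : ℕ)) : ℝ) / supNorm (x'.1 - x.1)) ^ α ≤ 1 := by
    have := holderWeight_le (le_refl 1) hσ1 hα0 hα1
    simpa using this
  have hterm : ∀ z : ↥(boxDom (fun i => 1 * M i)),
      |((((1 : ℕ)) : ℝ) / supNorm (x'.1 - x.1)) ^ α * ((((1 : ℕ)) : ℝ) *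
          ((G x' (fwd (fun i => 1 * M i) μ z) - G x' z) - (G x (fwd (fun i => 1 * M i) μ z) - G x z)))|
        * Real.exp (δ₀ * min (supNorm (x.1 - z.1)) (supNorm (x'.1 - z.1)) / (((1 : ℕ)) : ℝ))
      ≤ |(((1 : ℕ)) : ℝ) * (G x' (fwd (fun i => 1 * M i) μ z) - G x' z)|
          * Real.exp (δ₀ * supNorm (x'.1 - z.1) / (((1 : ℕ)) : ℝ))
        + |(((1 : ℕ)) : ℝ) * (G x (fwd (fun i => 1 * M i) μ z) - G x z)|
          * Real.exp (δ₀ * supNorm (x.1 - z.1) / (((1 : ℕ)) : ℝ)) := by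
    intro z
    have hsplit : |((((1 : ℕ)) : ℝ) / supNorm (x'.1 - x.1)) ^ α * ((((1 : ℕ)) : ℝ) *
        ((G x' (fwd (fun i => 1 * M i) μ z) - G x' z) - (G x (fwd (fun i => 1 * M i) μ z) - G x z)))|
        ≤ |(((1 : ℕ)) : ℝ) * (G x' (fwd (fun i => 1 * M i) μ z) - G x' z)|
          + |(((1 : ℕ)) : ℝ) * (G x (fwd (fun i => 1 * M i) μ z) - G x z)| := by
      rw [abs_mul, abs_of_nonneg hw0]
      calc ((((1 : ℕ)) : ℝ) / supNorm (x'.1 - x.1)) ^ α * |(((1 : ℕ)) : ℝ) *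
              ((G x' (fwd (fun i => 1 * M i) μ z) - G x' z) - (G x (fwd (fun i => 1 * M i) μ z) - G x z))|
          ≤ 1 * |(((1 : ℕ)) : ℝ) *
              ((G x' (fwd (fun i => 1 * M i) μ z) - G x' z) - (G x (fwd (fun i => 1 * M i) μ z) - G x z))| :=
            mul_le_mul_of_nonneg_right hw1 (abs_nonneg _)
        _ = |(((1 : ℕ)) : ℝ) * (G x' (fwd (fun i => 1 * M i) μ z) - G x' z)
              - (((1 : ℕ)) : ℝ) * (G x (fwd (fun i => 1 * M i) μ z) - G x z)| := by
            rw [one_mul, ← mul_sub]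
        _ ≤ _ := abs_sub _ _
    have he1 : Real.exp (δ₀ * min (supNorm (x.1 - z.1)) (supNorm (x'.1 - z.1)) / (((1 : ℕ)) : ℝ))
        ≤ Real.exp (δ₀ * supNorm (x'.1 - z.1) / (((1 : ℕ)) : ℝ)) :=
      Real.exp_le_exp.2 (div_le_div_of_nonneg_right
        (mul_le_mul_of_nonneg_left (min_le_right _ _) hδ.le) (Nat.cast_nonneg 1))
    have he2 : Real.exp (δ₀ * min (supNorm (x.1 - z.1)) (supNorm (x'.1 - z.1)) / (((1 : ℕ)) : ℝ))
        ≤ Real.exp (δ₀ * supNorm (x.1 - z.1) / (((1 : ℕ)) : ℝ)) :=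
      Real.exp_le_exp.2 (div_le_div_of_nonneg_right
        (mul_le_mul_of_nonneg_left (min_le_left _ _) hδ.le) (Nat.cast_nonneg 1))
    have hE := Real.exp_pos (δ₀ * min (supNorm (x.1 - z.1)) (supNorm (x'.1 - z.1)) / (((1 : ℕ)) : ℝ))
    calc _ ≤ (|(((1 : ℕ)) : ℝ) * (G x' (fwd (fun i => 1 * M i) μ z) - G x' z)|
            + |(((1 : ℕ)) : ℝ) * (G x (fwd (fun i => 1 * M i) μ z) - G x z)|)
          * Real.exp (δ₀ * min (supNorm (x.1 - z.1)) (supNorm (x'.1 - z.1)) / (((1 : ℕ)) : ℝ)) :=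
          mul_le_mul_of_nonneg_right hsplit hE.le
      _ ≤ _ := by
          rw [add_mul]
          exact add_le_add (mul_le_mul_of_nonneg_left he1 (abs_nonneg _))
            (mul_le_mul_of_nonneg_left he2 (abs_nonneg _))
  calc _ ≤ ∑ z, (|(((1 : ℕ)) : ℝ) * (G x' (fwd (fun i => 1 * M i) μ z) - G x' z)|
            * Real.exp (δ₀ * supNorm (x'.1 - z.1) / (((1 : ℕ)) : ℝ))
        + |(((1 : ℕ)) : ℝ) * (G x (fwd (fun i => 1 * M i) μ z) - G x z)|
            * Real.exp (δ₀ * supNorm (x.1 - z.1) / (((1 : ℕ)) : ℝ))) :=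
        Finset.sum_le_sum fun z _ => hterm z
    _ ≤ c + c := by rw [Finset.sum_add_distrib]; exact add_le_add hA hB
    _ = 2 * c := by ring

/-! ## §3 THE ALL-SCALES FORMS (`k ≥ 0`): the three lineage theorems with the binder «1 ≤ k» removed -/

/-- **LEMMA 2.2 (2.17) FOR `G_k(□)D^{η*}_μ` AT `A = 0` WITH THE LITERAL COEFFICIENT, ALL SCALES `k ≥ 0`** (weighted
columns of `η⁻¹(G(x′, fwd_μx) − G(x′, x))`): `B4Lemma22ZeroBoxDerivDual.lemma22_zero_box_Gdstar_roww_coeff` (`k ≥ 1`)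
and `lemma22_zero_box_Gdstar_wsum_meshOne` (`k = 0`), constants merged.
[cite: Balaban1983RegularityDecay, Lemma 2.2 (2.17) pp.577–578 with (1.6) p.572; p.583 (2.40)–(2.41)] -/
theorem lemma22_zero_box_Gdstar_roww_coeff_all (d ℓ : ℕ) (hℓ : 1 ≤ ℓ) (amin aplus m2plus : ℝ) (ha : 0 < amin) :
    ∃ δ₀ c₀ : ℝ, 0 < δ₀ ∧ 0 < c₀ ∧ ∀ (k : ℕ) (a m2 : ℝ), amin ≤ a → a ≤ aplus → 0 ≤ m2 →
      m2 ≤ m2plus → ∀ (M : Fin (d + 1) → ℕ), (∀ i, 1 ≤ M i) →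
        ∀ (μ : Fin (d + 1)) (x' : ↥(boxDom (fun i => (ℓ + 1) ^ k * M i))),
          ∑ x, |(((ℓ + 1) ^ k : ℕ) : ℝ) *
                ((boxOpR ((ℓ + 1) ^ k) a m2 M)⁻¹ x' (fwd (fun i => (ℓ + 1) ^ k * M i) μ x)
                  - (boxOpR ((ℓ + 1) ^ k) a m2 M)⁻¹ x' x)|
              * Real.exp (δ₀ * supNorm (x'.1 - x.1) / (((ℓ + 1) ^ k : ℕ) : ℝ)) ≤ c₀ := by
  obtain ⟨δ₁, c₁, hδ₁, hc₁, h₁⟩ := lemma22_zero_box_Gdstar_roww_coeff d ℓ hℓ amin aplus m2plus ha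
  obtain ⟨δ₂, c₂, hδ₂, hc₂, h₂⟩ := lemma22_zero_box_Gdstar_wsum_meshOne d amin aplus m2plus ha
  have mono : ∀ {N : Fin (d + 1) → ℕ} {δ δ' : ℝ}, δ' ≤ δ → ∀ (n : ℕ) (z : ↥(boxDom N)) (g : ↥(boxDom N) → ℝ),
      wsum δ' n z g ≤ wsum δ n z g := by
    intro N δ δ' hle n z g
    unfold wsum
    refine Finset.sum_le_sum fun z' _ => mul_le_mul_of_nonneg_left ?_ (abs_nonneg _)
    exact Real.exp_le_exp.2 (div_le_div_of_nonneg_right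
      (mul_le_mul_of_nonneg_right hle (supNorm_nonneg _)) (Nat.cast_nonneg n))
  refine ⟨min δ₁ δ₂, max c₁ c₂, lt_min hδ₁ hδ₂, lt_max_of_lt_left hc₁, ?_⟩
  intro k
  rcases Nat.eq_zero_or_pos k with rfl | hk
  · intro a m2 h1 h2 h3 h4 M _ μ x'
    have hx := h₂ a m2 h1 h2 h3 h4 M μ x'
    have hm := mono (min_le_right δ₁ δ₂) 1 x' (fun x => (((1 : ℕ)) : ℝ) *
      ((boxOpR 1 a m2 M)⁻¹ x' (fwd (fun i => 1 * M i) μ x) - (boxOpR 1 a m2 M)⁻¹ x' x))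
    have : wsum (min δ₁ δ₂) 1 x' (fun x => (((1 : ℕ)) : ℝ) *
        ((boxOpR 1 a m2 M)⁻¹ x' (fwd (fun i => 1 * M i) μ x) - (boxOpR 1 a m2 M)⁻¹ x' x)) ≤ max c₁ c₂ :=
      (hm.trans hx).trans (le_max_right _ _)
    unfold wsum at this
    exact this
  · intro a m2 h1 h2 h3 h4 M hM μ x'
    have hx := h₁ k hk a m2 h1 h2 h3 h4 M hM μ x'
    have hm := mono (min_le_left δ₁ δ₂) ((ℓ + 1) ^ k) x' (fun x => (((ℓ + 1) ^ k : ℕ) : ℝ) *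
      ((boxOpR ((ℓ + 1) ^ k) a m2 M)⁻¹ x' (fwd (fun i => (ℓ + 1) ^ k * M i) μ x)
        - (boxOpR ((ℓ + 1) ^ k) a m2 M)⁻¹ x' x))
    unfold wsum at hm
    exact (hm.trans hx).trans (le_max_left _ _)

/-- **THE COLUMN COMPANION OF (1.9) AT `A = 0` WITH THE LITERAL COEFFICIENT, ALL SCALES `k ≥ 0`** (`0 ≤ α < 1`):
`B4Thm19ZeroBoxHolderDual.thm19Dual_zero_box_roww_coeff` (`k ≥ 1`) and `thm19Dual_zero_box_wsum2_meshOne` (`k = 0`).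
[cite: Balaban1983RegularityDecay, p. 573 Theorem (1.9) with (1.6) p. 572; p. 583 (2.40)–(2.41)]
[cite: Balaban1984PropagatorsII, p. 234 Proposition 2.2 (2.67)] -/
theorem thm19Dual_zero_box_roww_coeff_all (d ℓ : ℕ) (hℓ : 1 ≤ ℓ) (amin aplus m2plus : ℝ) (ha : 0 < amin)
    (α : ℝ) (hα0 : 0 ≤ α) (hα1 : α < 1) :
    ∃ δ₀ c₀ : ℝ, 0 < δ₀ ∧ 0 < c₀ ∧ ∀ (k : ℕ) (a m2 : ℝ), amin ≤ a → a ≤ aplus → 0 ≤ m2 →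
      m2 ≤ m2plus → ∀ (M : Fin (d + 1) → ℕ), (∀ i, 1 ≤ M i) →
        ∀ (μ : Fin (d + 1)) (x x' : ↥(boxDom (fun i => (ℓ + 1) ^ k * M i))), x'.1 ≠ x.1 →
          ∑ z, |((((ℓ + 1) ^ k : ℕ) : ℝ) / supNorm (x'.1 - x.1)) ^ α * ((((ℓ + 1) ^ k : ℕ) : ℝ) *
                (((boxOpR ((ℓ + 1) ^ k) a m2 M)⁻¹ x' (fwd (fun i => (ℓ + 1) ^ k * M i) μ z)
                    - (boxOpR ((ℓ + 1) ^ k) a m2 M)⁻¹ x' z)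
                  - ((boxOpR ((ℓ + 1) ^ k) a m2 M)⁻¹ x (fwd (fun i => (ℓ + 1) ^ k * M i) μ z)
                    - (boxOpR ((ℓ + 1) ^ k) a m2 M)⁻¹ x z)))|
              * Real.exp (δ₀ * min (supNorm (x.1 - z.1)) (supNorm (x'.1 - z.1)) / (((ℓ + 1) ^ k : ℕ) : ℝ))
            ≤ c₀ := by
  obtain ⟨δ₁, c₁, hδ₁, hc₁, h₁⟩ := thm19Dual_zero_box_roww_coeff d ℓ hℓ amin aplus m2plus ha α hα0 hα1
  obtain ⟨δ₂, c₂, hδ₂, hc₂, h₂⟩ := thm19Dual_zero_box_wsum2_meshOne d amin aplus m2plus ha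
  refine ⟨min δ₁ δ₂, max c₁ c₂, lt_min hδ₁ hδ₂, lt_max_of_lt_left hc₁, ?_⟩
  intro k
  rcases Nat.eq_zero_or_pos k with rfl | hk
  · intro a m2 h1 h2 h3 h4 M _ μ x x' hne
    have hx := h₂ α hα0 hα1.le a m2 h1 h2 h3 h4 M μ x x' hne
    have hm := wsum2_mono_rate (min_le_right δ₁ δ₂) 1 x x'
      (fun z => ((((1 : ℕ)) : ℝ) / supNorm (x'.1 - x.1)) ^ α * ((((1 : ℕ)) : ℝ) *
        (((boxOpR 1 a m2 M)⁻¹ x' (fwd (fun i => 1 * M i) μ z) - (boxOpR 1 a m2 M)⁻¹ x' z)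
          - ((boxOpR 1 a m2 M)⁻¹ x (fwd (fun i => 1 * M i) μ z) - (boxOpR 1 a m2 M)⁻¹ x z))))
    unfold wsum2 at hm
    exact (hm.trans hx).trans (le_max_right _ _)
  · intro a m2 h1 h2 h3 h4 M hM μ x x' hne
    have hx := h₁ k hk a m2 h1 h2 h3 h4 M hM μ x x' hne
    have hm := wsum2_mono_rate (min_le_left δ₁ δ₂) ((ℓ + 1) ^ k) x x'
      (fun z => ((((ℓ + 1) ^ k : ℕ) : ℝ) / supNorm (x'.1 - x.1)) ^ α * ((((ℓ + 1) ^ k : ℕ) : ℝ) *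
        (((boxOpR ((ℓ + 1) ^ k) a m2 M)⁻¹ x' (fwd (fun i => (ℓ + 1) ^ k * M i) μ z)
            - (boxOpR ((ℓ + 1) ^ k) a m2 M)⁻¹ x' z)
          - ((boxOpR ((ℓ + 1) ^ k) a m2 M)⁻¹ x (fwd (fun i => (ℓ + 1) ^ k * M i) μ z)
            - (boxOpR ((ℓ + 1) ^ k) a m2 M)⁻¹ x z))))
    unfold wsum2 at hm
    exact (hm.trans hx).trans (le_max_left _ _)

/-- **THE COLUMN COMPANION, PRINTED QUANTIFIER ORDER `∃ δ₀ ∀ α ∃ c₀(α)`, ALL SCALES `k ≥ 0`**: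
`B4Thm19ZeroBoxHolderDualRateUnif.thm19Dual_zero_box_roww_coeff_unif` (`k ≥ 1`) merged with
`thm19Dual_zero_box_wsum2_meshOne` (`k = 0`) — the form consumed by the level-0 twin of
`B6Ineq243HolderDualTwoLevelBox.ineq243_twoLevel_holderDual_wsum2`.
[cite: Balaban1983RegularityDecay, Theorem (Prop. 2.1 of [1]) (1.9) p.573 with (1.6) p.572; p.583 (2.40)–(2.41)] -/
theorem thm19Dual_zero_box_roww_coeff_unif_all (d ℓ : ℕ) (hℓ : 1 ≤ ℓ) (amin aplus m2plus : ℝ) (ha : 0 < amin) :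
    ∃ δ₀ : ℝ, 0 < δ₀ ∧ ∀ (α : ℝ), 0 ≤ α → α < 1 → ∃ c₀ : ℝ, 0 < c₀ ∧ ∀ (k : ℕ) (a m2 : ℝ), amin ≤ a →
      a ≤ aplus → 0 ≤ m2 → m2 ≤ m2plus → ∀ (M : Fin (d + 1) → ℕ), (∀ i, 1 ≤ M i) →
        ∀ (μ : Fin (d + 1)) (x x' : ↥(boxDom (fun i => (ℓ + 1) ^ k * M i))), x'.1 ≠ x.1 →
          ∑ z, |((((ℓ + 1) ^ k : ℕ) : ℝ) / supNorm (x'.1 - x.1)) ^ α * ((((ℓ + 1) ^ k : ℕ) : ℝ) *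
                (((boxOpR ((ℓ + 1) ^ k) a m2 M)⁻¹ x' (fwd (fun i => (ℓ + 1) ^ k * M i) μ z)
                    - (boxOpR ((ℓ + 1) ^ k) a m2 M)⁻¹ x' z)
                  - ((boxOpR ((ℓ + 1) ^ k) a m2 M)⁻¹ x (fwd (fun i => (ℓ + 1) ^ k * M i) μ z)
                    - (boxOpR ((ℓ + 1) ^ k) a m2 M)⁻¹ x z)))|
              * Real.exp (δ₀ * min (supNorm (x.1 - z.1)) (supNorm (x'.1 - z.1)) / (((ℓ + 1) ^ k : ℕ) : ℝ))
            ≤ c₀ := by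
  obtain ⟨δ₁, hδ₁, hA⟩ := thm19Dual_zero_box_roww_coeff_unif d ℓ hℓ amin aplus m2plus ha
  obtain ⟨δ₂, c₂, hδ₂, hc₂, h₂⟩ := thm19Dual_zero_box_wsum2_meshOne d amin aplus m2plus ha
  refine ⟨min δ₁ δ₂, lt_min hδ₁ hδ₂, fun α hα0 hα1 => ?_⟩
  obtain ⟨c₁, hc₁, h₁⟩ := hA α hα0 hα1
  refine ⟨max c₁ c₂, lt_max_of_lt_left hc₁, ?_⟩
  intro k
  rcases Nat.eq_zero_or_pos k with rfl | hk
  · intro a m2 h1 h2 h3 h4 M _ μ x x' hne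
    have hx := h₂ α hα0 hα1.le a m2 h1 h2 h3 h4 M μ x x' hne
    have hm := wsum2_mono_rate (min_le_right δ₁ δ₂) 1 x x'
      (fun z => ((((1 : ℕ)) : ℝ) / supNorm (x'.1 - x.1)) ^ α * ((((1 : ℕ)) : ℝ) *
        (((boxOpR 1 a m2 M)⁻¹ x' (fwd (fun i => 1 * M i) μ z) - (boxOpR 1 a m2 M)⁻¹ x' z)
          - ((boxOpR 1 a m2 M)⁻¹ x (fwd (fun i => 1 * M i) μ z) - (boxOpR 1 a m2 M)⁻¹ x z))))
    unfold wsum2 at hm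
    exact (hm.trans hx).trans (le_max_right _ _)
  · intro a m2 h1 h2 h3 h4 M hM μ x x' hne
    have hx := h₁ k hk a m2 h1 h2 h3 h4 M hM μ x x' hne
    have hm := wsum2_mono_rate (min_le_left δ₁ δ₂) ((ℓ + 1) ^ k) x x'
      (fun z => ((((ℓ + 1) ^ k : ℕ) : ℝ) / supNorm (x'.1 - x.1)) ^ α * ((((ℓ + 1) ^ k : ℕ) : ℝ) *
        (((boxOpR ((ℓ + 1) ^ k) a m2 M)⁻¹ x' (fwd (fun i => (ℓ + 1) ^ k * M i) μ z)
            - (boxOpR ((ℓ + 1) ^ k) a m2 M)⁻¹ x' z)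
          - ((boxOpR ((ℓ + 1) ^ k) a m2 M)⁻¹ x (fwd (fun i => (ℓ + 1) ^ k * M i) μ z)
            - (boxOpR ((ℓ + 1) ^ k) a m2 M)⁻¹ x z))))
    unfold wsum2 at hm
    exact (hm.trans hx).trans (le_max_left _ _)

/-! ## §4 Non-vacuity (`d + 1 = 4`, `L = 2`, `α = 1/2`, window `a ∈ [1/2, 2]`, `m² ∈ [0, 1]`) -/

/-- the all-scales column companion at the physical dimension `d + 1 = 4`, `L = 2`, `α = 1/2`. -/
example : ∃ δ₀ c₀ : ℝ, 0 < δ₀ ∧ 0 < c₀ ∧ ∀ (k : ℕ) (a m2 : ℝ), (1 / 2 : ℝ) ≤ a → a ≤ 2 → 0 ≤ m2 →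
      m2 ≤ 1 → ∀ (M : Fin (3 + 1) → ℕ), (∀ i, 1 ≤ M i) →
        ∀ (μ : Fin (3 + 1)) (x x' : ↥(boxDom (fun i => (1 + 1) ^ k * M i))), x'.1 ≠ x.1 →
          ∑ z, |((((1 + 1) ^ k : ℕ) : ℝ) / supNorm (x'.1 - x.1)) ^ (1 / 2 : ℝ) * ((((1 + 1) ^ k : ℕ) : ℝ) *
                (((boxOpR ((1 + 1) ^ k) a m2 M)⁻¹ x' (fwd (fun i => (1 + 1) ^ k * M i) μ z)
                    - (boxOpR ((1 + 1) ^ k) a m2 M)⁻¹ x' z)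
                  - ((boxOpR ((1 + 1) ^ k) a m2 M)⁻¹ x (fwd (fun i => (1 + 1) ^ k * M i) μ z)
                    - (boxOpR ((1 + 1) ^ k) a m2 M)⁻¹ x z)))|
              * Real.exp (δ₀ * min (supNorm (x.1 - z.1)) (supNorm (x'.1 - z.1)) / (((1 + 1) ^ k : ℕ) : ℝ))
            ≤ c₀ :=
  thm19Dual_zero_box_roww_coeff_all 3 1 le_rfl (1 / 2) 2 1 (by norm_num) (1 / 2) (by norm_num) (by norm_num)

/-- the mesh-one weighted column bound at `d + 1 = 4` (every box, every axis, every row index `x′`). -/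
example : ∃ δ₀ c₀ : ℝ, 0 < δ₀ ∧ 0 < c₀ ∧ ∀ (a m2 : ℝ), (1 / 2 : ℝ) ≤ a → a ≤ 2 → 0 ≤ m2 → m2 ≤ 1 →
      ∀ (M : Fin (3 + 1) → ℕ) (μ : Fin (3 + 1)) (x' : ↥(boxDom (fun i => 1 * M i))),
        wsum δ₀ 1 x' (fun x => (((1 : ℕ)) : ℝ) *
          ((boxOpR 1 a m2 M)⁻¹ x' (fwd (fun i => 1 * M i) μ x) - (boxOpR 1 a m2 M)⁻¹ x' x)) ≤ c₀ :=
  lemma22_zero_box_Gdstar_wsum_meshOne 3 (1 / 2) 2 1 (by norm_num)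

/-- the mesh-one binders are inhabited: window `a = 1`, `m² = 0`, the cube `M ≡ 2` (`k = 0` box `{0,1}^4`), the axis
`μ = 0`, the distinct points `x = 0`, `x′ = e_1` with their `μ`-neighbours `xe = e_0`, `xe′ = e_1 + e_0` in the box. -/
example : (1 / 2 : ℝ) ≤ 1 ∧ (1 : ℝ) ≤ 2 ∧ (0 : ℝ) ≤ 0 ∧ (0 : ℝ) ≤ 1
    ∧ (Pi.single (1 : Fin (3 + 1)) (1 : ℤ) : Fin (3 + 1) → ℤ) ≠ (fun _ => (0 : ℤ))
    ∧ (Pi.single (1 : Fin (3 + 1)) (1 : ℤ) + Pi.single (0 : Fin (3 + 1)) (1 : ℤ) : Fin (3 + 1) → ℤ)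
        ∈ boxDom (fun i : Fin (3 + 1) => (1 + 1) ^ 0 * (fun _ => 2 : Fin (3 + 1) → ℕ) i) := by
  refine ⟨by norm_num, by norm_num, le_rfl, by norm_num, ?_, ?_⟩
  · intro h
    have := congrFun h 1
    simp at this
  · refine mem_boxDom.2 fun i => ?_
    fin_cases i <;> simp

end

end Literature.MathematicalPhysics.QuantumFieldTheory.Balaban1983to89.B4Thm19ZeroBoxHolderDualMeshOne
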